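import Summits.ResolutionOfSingularities.ResolutionOfSingularities.Theorems.LossEntryW01
import HarnessLib

/-!
# LossEntryW02 — walk plumbing of the loss→entry law `LawLossEntry`, part 2/11

decomp-res-lens-3, gen 29 (HOME/decomp-res-lens-3/g29/NODE-g29.md).  TOOL at 0 toward the residual item
stmt-ResolutionOfSingularities-27367 (`WallCut.NoLossyStrictTailsDeep` ⟸ `LossEpisode.LawLossEntry`).  Imports part 1 (`Theorems.LossEntryW01`, to be landed first).

Contents: §3′/§4 the `u_j^T`-layer after a (b)-loss and the FORCED untranslated repeat (`repeat_after_loss_b`).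
-/

open MvPolynomial Finset
open Literature.AlgebraicGeometry.Resolution
open Literature.AlgebraicGeometry.Resolution.Hauser2010
open Literature.AlgebraicGeometry.Resolution.PointBlowup
open Summit.ResolutionOfSingularities.ResolutionOfSingularities.Theorems.TightDefectClasses
open Summit.ResolutionOfSingularities.ResolutionOfSingularities.Theorems.TightDefectStrongWalks
open Summit.ResolutionOfSingularities.ResolutionOfSingularities.Theorems.ItineraryCutClasses
open Summit.ResolutionOfSingularities.ResolutionOfSingularities.Theorems.BoundaryLedger
open Summit.ResolutionOfSingularities.ResolutionOfSingularities.Theorems.ProximityCut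
open Summit.ResolutionOfSingularities.ResolutionOfSingularities.Theorems.LossIsFatalLayer (chartMap chartMap_X chartMap_X_self
  chartMap_X_ne chartMap_C)
open Summit.ResolutionOfSingularities.ResolutionOfSingularities.Theorems.LossExitCone
open Summit.ResolutionOfSingularities.ResolutionOfSingularities.Theorems.LossPolygon

/-! ## §3′/§4 Walk form: the `u_j^T`-layer after a (b)-loss, and the forced repeat -/

namespace Summit.ResolutionOfSingularities.ResolutionOfSingularities.Theorems.LossEpisode

variable {K : Type} [Field K] [DecidableEq K] {q : ℕ} {s₀ : State (Fin 3) K}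

section Walk

variable {W : ForcedWalk q s₀} {N s : ℕ}

/-- At a run state `(i,j,l;k,m)` every monomial has degree `≥ k + m + s = ord F_u`. [`runState_ledger`] -/
theorem le_degree_of_mem_support_runState (hroot : IsRoot q s₀) (hT : TailHyp W N s) {u : ℕ} (hNu : N ≤ u) {i j l : Fin 3}
    {k m : ℕ} (hS : IsRunState W s u i j l k m) {D : Fin 3 →₀ ℕ} (hD : D ∈ (W.st u).F.support) : k + m + s ≤ D.degree := by
  have hord := (runState_ledger hroot hT hNu hS).1
  by_contra hlt
  exact (mem_support_iff.mp hD) (coeff_eq_zero_of_degree_lt_ordZero (by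
    rw [hord]; exact_mod_cast (by omega : D.degree < s + k + m)))

/-- … hence so has every monomial of the prepared equation `σ_{i,j,g} σ_{l,j,g'} F_u`. [folklore] -/
theorem le_degree_of_mem_support_prepared (hroot : IsRoot q s₀) (hT : TailHyp W N s) {u : ℕ} (hNu : N ≤ u) {i j l : Fin 3}
    {k m : ℕ} (hS : IsRunState W s u i j l k m) (g g' : K) {E : Fin 3 →₀ ℕ}
    (hE : E ∈ (shear i j g (shear l j g' (W.st u).F)).support) : k + m + s ≤ E.degree :=
  le_degree_of_mem_support_shear (Ne.symm hS.2.2.1) hS.1.symm hS.2.1 g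
    (fun _ hE' => le_degree_of_mem_support_shear (Ne.symm hS.1) (Ne.symm hS.2.2.1) hS.2.1.symm g'
      (fun _ hD' => le_degree_of_mem_support_runState hroot hT hNu hS hD') hE') hE

/-- **PENCIL DATA AT A (b)-LOSS (PROVED):** at a run state `(i,j,l;k,m)` on the tail whose move is in the chart `j` of the loss
wall, there is `φ₀ ≠ 0` with `coeff (r + E) F_t = φ₀ · coeff E (u_l − b_t(l) u_j)^s` for all `deg E = s`.
[`runState_pencil`, case (b)] -/
theorem pencil_of_loss_b (hroot : IsRoot q s₀) (hT : TailHyp W N s) {t : ℕ} (hNt : N ≤ t) {i j l : Fin 3} {k m : ℕ}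
    (hS : IsRunState W s t i j l k m) (hjt : W.j t = j) :
    ∃ φ₀ : K, φ₀ ≠ 0 ∧ ∀ E : Fin 3 →₀ ℕ, E.degree = s →
      coeff ((W.st t).r + E) (W.st t).F = φ₀ * coeff E ((X l - C (W.b t l) * X j) ^ s) := by
  have hij : i ≠ j := hS.1
  have hlj : l ≠ j := hS.2.2.1
  obtain ⟨φ₀, lam, hφ₀, hpen, hcase⟩ :=
    runState_pencil hroot hT hNt hS (fun h => hij (h.1.symm.trans hjt))
  rcases hcase with ⟨-, hlam⟩ | ⟨hl, -⟩ | ⟨hi, -⟩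
  · exact ⟨φ₀, hφ₀, by rw [hlam]; exact hpen⟩
  · exact absurd (hjt.symm.trans hl) (Ne.symm hlj)
  · exact absurd (hjt.symm.trans hi) (Ne.symm hij)

/-- **THE `u_j^T`-LAYER AFTER A (b)-LOSS LIES ON THE CEILING (PROVED):** after a loss at `t` from the run state `(i,j,l;k,m)` in the
chart `j`, every monomial `u^D` of `F_{t+1}` with `D j = k + m + s − q` has `D l ≥ s` (indeed `= s`). [NODE-g28 F19; new] -/
theorem le_thd_of_mem_support_succ_loss_b (hroot : IsRoot q s₀) (hT : TailHyp W N s) {t : ℕ} (hNt : N ≤ t) {i j l : Fin 3}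
    {k m : ℕ} (hS : IsRunState W s t i j l k m) (hjt : W.j t = j) {D : Fin 3 →₀ ℕ} (hD : D ∈ (W.st (t + 1)).F.support)
    (hDj : D j = k + m + s - q) : s ≤ D l := by
  classical
  have hq := (runState_ledger hroot hT hNt hS).2.1
  have hrl := hS.r_apply.2.2
  have hij : i ≠ j := hS.1
  have hli : l ≠ i := hS.2.1
  have hlj : l ≠ j := hS.2.2.1
  obtain ⟨φ₀, -, hpen⟩ := pencil_of_loss_b hroot hT hNt hS hjt
  have hro : (W.st t).r.degree + s = k + m + s := by
    rw [hS.2.2.2.2.2.1, map_add, Finsupp.degree_single, Finsupp.degree_single]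
  rw [support_succ_two_shears hroot W t hij hlj hli.symm hjt, Finset.mem_image] at hD
  obtain ⟨E, hE, hED⟩ := hD
  have hEsupp := (Finset.mem_filter.mp hE).1
  have hoE : k + m + s ≤ E.degree := le_degree_of_mem_support_prepared hroot hT hNt hS _ _ hEsupp
  have h1 : D j = E.degree - q := by rw [← hED, chartExponent_apply, if_pos rfl]
  have hEdeg : E.degree = k + m + s := by omega
  have hEl : E l = s :=
    thd_eq_of_mem_support_two_shears hij hli.symm (Ne.symm hlj) hrl hro φ₀ (W.b t l) (W.b t i)
      (walk_r hroot W t) hpen hEsupp hEdeg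
  rw [← hED, chartExponent_apply, if_neg hlj, hEl]

/-- **THE APEX `u_j^T u_l^s` OF `F_{t+1}` AFTER A (b)-LOSS (PROVED):** its coefficient is `φ₀ φ^k ≠ 0` (`φ = b_t(i) ≠ 0`).
[NODE-g28 F19; new] -/
theorem coeff_succ_loss_b_apex_ne_zero (hroot : IsRoot q s₀) (hT : TailHyp W N s) {t : ℕ} (hNt : N ≤ t) {i j l : Fin 3}
    {k m : ℕ} (hS : IsRunState W s t i j l k m) (hjt : W.j t = j) (hbi : W.b t i ≠ 0) :
    coeff (Finsupp.single j (k + m + s - q) + Finsupp.single l s) (W.st (t + 1)).F ≠ 0 := by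
  classical
  have hq := (runState_ledger hroot hT hNt hS).2.1
  obtain ⟨hri, hrj, hrl⟩ := hS.r_apply
  have hij : i ≠ j := hS.1
  have hli : l ≠ i := hS.2.1
  have hlj : l ≠ j := hS.2.2.1
  have hsq : s < q := hT.s_lt
  have h1s : 1 ≤ s := hT.one_le
  obtain ⟨φ₀, hφ₀, hpen⟩ := pencil_of_loss_b hroot hT hNt hS hjt
  have hro : (W.st t).r.degree + s = k + m + s := by
    rw [hS.2.2.2.2.2.1, map_add, Finsupp.degree_single, Finsupp.degree_single]
  set E : Fin 3 →₀ ℕ := Finsupp.single j (k + m) + Finsupp.single l s with hEdef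
  have hEdeg : E.degree = k + m + s := by rw [hEdef, map_add, Finsupp.degree_single, Finsupp.degree_single]
  have hqE : q ≤ E.degree := by rw [hEdeg]; omega
  have hEi : E i = 0 := by simp [hEdef, Ne.symm hij, hli]
  have hEj : E j = k + m := by simp [hEdef, hlj]
  have hEl : E l = s := by simp [hEdef, Ne.symm hlj]
  have hPE : ¬ IsPthPowerExponent q E := by
    rw [isPthPowerExponent_iff]
    intro h
    have := Nat.le_of_dvd (by omega) (hEl ▸ h l)
    omega
  have hcE : chartExponent q j E = Finsupp.single j (k + m + s - q) + Finsupp.single l s := by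
    ext w
    rw [chartExponent_apply]
    rcases fin3_eq_or i j l w hij hli.symm (Ne.symm hlj) with rfl | rfl | rfl
    · rw [if_neg hij, hEi]; simp [Ne.symm hij, hli]
    · rw [if_pos rfl, hEdeg]; simp [hlj]
    · rw [if_neg hlj, hEl]; simp [Ne.symm hlj]
  rw [← hcE, coeff_succ_two_shears hroot W t hij hlj hli.symm hjt hqE hPE]
  have happ := coeff_two_shears_apex hij hli.symm (Ne.symm hlj) hrl hro φ₀ (W.b t l) (W.b t i) (walk_r hroot W t) hpen
  rw [hri, hrj] at happ
  rw [hEdef, happ]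
  exact mul_ne_zero hφ₀ (pow_ne_zero _ hbi)

/-- **THE REPEAT AFTER A (b)-LOSS IS THE UNTRANSLATED `u_i`-CHART (PROVED):** after a loss at `t ≥ N` from a run state
`(i,j,l;k,m)` in the chart of the loss wall `j` (`b_t(i) ≠ 0`) followed by a proximity repeat, the repeat is in the chart of the
old run wall `i` and is untranslated.  [desk finding R3(b)/F19 of NODE-g28 §6.8; CJS2020 §13 for the walk; new] -/
theorem repeat_after_loss_b (hroot : IsRoot q s₀) (hT : TailHyp W N s) {t : ℕ} (hNt : N ≤ t) {i j l : Fin 3} {k m : ℕ}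
    (hS : IsRunState W s t i j l k m) (hjt : W.j t = j) (hbi : W.b t i ≠ 0) (hloss : IsLossMove W t)
    (hst : StaysOnNewest W t) : W.j (t + 1) = i ∧ W.b (t + 1) = 0 := by
  classical
  obtain ⟨hord, hq, hks, hms, -⟩ := runState_ledger hroot hT hNt hS
  have hij : i ≠ j := hS.1
  have hli : l ≠ i := hS.2.1
  have hlj : l ≠ j := hS.2.2.1
  have hsq : s < q := hT.s_lt
  have h1s : 1 ≤ s := hT.one_le
  -- the shape two moves later
  obtain ⟨T, hoT, h1T, hr1, hqT, hnext⟩ := lossMove_next hroot hT hNt hloss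
  have hTo : T = k + m + s - q := by
    have h := hord.symm.trans hoT
    have h' : s + k + m = q + T := by exact_mod_cast h
    omega
  rcases hnext with ⟨hnst, -, -⟩ | ⟨-, l₂, d, hl₂i, hl₂j, hTd, h1d, hS2⟩
  · exact absurd hst hnst
  have hord2 : ordZero (W.st (t + 2)).F = ((s + d + T : ℕ) : ℕ∞) := (runState_ledger hroot hT (by omega) hS2).1
  -- the apex `u_j^T u_l^s` of `F_{t+1}` and the ceiling of its `u_j^T`-layer
  have hapex := coeff_succ_loss_b_apex_ne_zero hroot hT hNt hS hjt hbi
  rw [← hTo] at hapex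
  have hceil : ∀ D ∈ (W.st (t + 1)).F.support, D j = T → s ≤ D l := fun D hD hDj =>
    le_thd_of_mem_support_succ_loss_b hroot hT hNt hS hjt hD (by rw [hDj, hTo])
  set A : Fin 3 →₀ ℕ := Finsupp.single j T + Finsupp.single l s with hA
  have hAj : A j = T := by simp [hA, hlj]
  have hAl : A l = s := by simp [hA, Ne.symm hlj]
  have hAi : A i = 0 := by simp [hA, Ne.symm hij, hli]
  have hAdeg : A.degree = T + s := by rw [hA, map_add, Finsupp.degree_single, Finsupp.degree_single]
  -- a monomial of degree `T + d` cannot occur in `F_{t+2}`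
  have hvanish : ∀ D : Fin 3 →₀ ℕ, D.degree = T + d → coeff D (W.st (t + 2)).F = 0 := fun D hD =>
    coeff_eq_zero_of_degree_lt_ordZero (by rw [hord2, hD]; exact_mod_cast (by omega : T + d < s + d + T))
  have hj1 : W.j (t + 1) ≠ j := fun h => hst.1 (h.trans hjt.symm)
  have hbj1 : W.b (t + 1) j = 0 := by have := hst.2; rwa [hjt] at this
  rcases fin3_eq_or i j l (W.j (t + 1)) hij hli.symm (Ne.symm hlj) with hci | hcj | hcl
  · -- chart `i`: the translation along `l` vanishes
    refine ⟨hci, ?_⟩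
    have hbi1 : W.b (t + 1) i = 0 := by rw [← hci]; exact W.onExc (t + 1)
    by_contra hb
    have hμ : W.b (t + 1) l ≠ 0 := by
      intro h0; apply hb; funext w
      rcases fin3_eq_or i j l w hij hli.symm (Ne.symm hlj) with rfl | rfl | rfl
      · exact hbi1
      · exact hbj1
      · exact h0
    have hbw : ∀ w, w ≠ l → W.b (t + 1) w = 0 := fun w hw => by
      rcases fin3_eq_or i j l w hij hli.symm (Ne.symm hlj) with rfl | rfl | rfl
      · exact hbi1
      · exact hbj1
      · exact absurd rfl hw
    -- the exponent `u_i^s u_j^T` of the sheared equation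
    set B : Fin 3 →₀ ℕ := Finsupp.single i s + Finsupp.single j T with hB
    have hBi : B i = s := by simp [hB, Ne.symm hij]
    have hBj : B j = T := by simp [hB, hij]
    have hBl : B l = 0 := by simp [hB, Ne.symm hli, Ne.symm hlj]
    have hBdeg : B.degree = s + T := by rw [hB, map_add, Finsupp.degree_single, Finsupp.degree_single]
    have hPB : ¬ IsPthPowerExponent q B := by
      rw [isPthPowerExponent_iff]; intro h
      have := Nat.le_of_dvd (by omega) (hBi ▸ h i); omega
    have hAB : shearExp i j l A s = B := by
      ext w
      rcases fin3_eq_or i j l w hij hli.symm (Ne.symm hlj) with rfl | rfl | rfl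
      · rw [shearExp_apply_fst hij (Ne.symm hli), hAi, hBi, zero_add]
      · rw [shearExp_apply_snd hij (Ne.symm hlj), hAj, hBj]
      · rw [shearExp_apply_thd (Ne.symm hli) (Ne.symm hlj), hAl, hBl, Nat.sub_self]
    have hcoefB : coeff B (shear l i (W.b (t + 1) l) (W.st (t + 1)).F) =
        coeff A (W.st (t + 1)).F * W.b (t + 1) l ^ s * ((s.choose s : ℕ) : K) := by
      rw [coeff_shear hij (Ne.symm hli) (Ne.symm hlj), Finset.sum_eq_single A]
      · rw [hAl, Finset.sum_eq_single s]
        · rw [if_pos hAB]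
        · intro n hn hns
          rw [if_neg]; intro h
          have := congrArg (fun E => E i) h
          simp only [shearExp_apply_fst hij (Ne.symm hli), hAi, hBi, zero_add] at this
          exact hns this
        · intro h; exact absurd (Finset.mem_range.mpr (Nat.lt_succ_self s)) h
      · intro D hD hDA
        refine Finset.sum_eq_zero fun n hn => ?_
        rw [if_neg]; intro h
        have hn' : n ≤ D l := Nat.lt_succ_iff.mp (Finset.mem_range.mp hn)
        have h_i := congrArg (fun E => E i) h
        have h_j := congrArg (fun E => E j) h
        have h_l := congrArg (fun E => E l) h
        simp only [shearExp_apply_fst hij (Ne.symm hli), shearExp_apply_snd hij (Ne.symm hlj),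
          shearExp_apply_thd (Ne.symm hli) (Ne.symm hlj), hBi, hBj, hBl] at h_i h_j h_l
        have hsl : s ≤ D l := hceil D hD h_j
        apply hDA; ext w
        rcases fin3_eq_or i j l w hij hli.symm (Ne.symm hlj) with rfl | rfl | rfl
        · rw [hAi]; omega
        · rw [hAj]; exact h_j
        · rw [hAl]; omega
      · intro hA'; exact absurd (mem_support_iff.mpr hapex) hA'
    have hBsupp : B ∈ (shear l i (W.b (t + 1) l) (W.st (t + 1)).F).support := by
      rw [mem_support_iff, hcoefB, Nat.choose_self, Nat.cast_one, mul_one]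
      exact mul_ne_zero hapex (pow_ne_zero _ hμ)
    have hmem : chartExponent q i B ∈ (W.st (t + 1 + 1)).F.support := by
      rw [support_succ_shear hroot W (t + 1) hli hci hbw, Finset.mem_image]
      exact ⟨B, Finset.mem_filter.mpr ⟨hBsupp, hPB⟩, rfl⟩
    have hdeg : (chartExponent q i B).degree = T + d := by
      rw [degree_fin3 hij hli.symm (Ne.symm hlj), chartExponent_apply, if_pos rfl, chartExponent_apply, if_neg hij.symm,
        chartExponent_apply, if_neg hli, hBdeg, hBj, hBl]
      omega
    exact (mem_support_iff.mp hmem) (hvanish _ hdeg)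
  · exact absurd hcj hj1
  · -- chart `l`: impossible
    exfalso
    have hbl1 : W.b (t + 1) l = 0 := by rw [← hcl]; exact W.onExc (t + 1)
    have hbw : ∀ w, w ≠ i → W.b (t + 1) w = 0 := fun w hw => by
      rcases fin3_eq_or i j l w hij hli.symm (Ne.symm hlj) with rfl | rfl | rfl
      · exact absurd rfl hw
      · exact hbj1
      · exact hbl1
    have hPA : ¬ IsPthPowerExponent q A := by
      rw [isPthPowerExponent_iff]; intro h
      have := Nat.le_of_dvd (by omega) (hAl ▸ h l); omega
    have hcoefA : coeff A (shear i l (W.b (t + 1) i) (W.st (t + 1)).F) = coeff A (W.st (t + 1)).F := by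
      refine coeff_shear_eq_coeff hlj hli hij.symm (W.b (t + 1) i) _ fun D hD n h1n hnD h => ?_
      have h_j := congrArg (fun E => E j) h
      have h_l := congrArg (fun E => E l) h
      simp only [shearExp_apply_snd hlj hij.symm, shearExp_apply_fst hlj hli, hAj, hAl] at h_j h_l
      have := hceil D hD h_j
      omega
    have hAsupp : A ∈ (shear i l (W.b (t + 1) i) (W.st (t + 1)).F).support := by
      rw [mem_support_iff, hcoefA]; exact hapex
    have hmem : chartExponent q l A ∈ (W.st (t + 1 + 1)).F.support := by
      rw [support_succ_shear hroot W (t + 1) (Ne.symm hli) hcl hbw, Finset.mem_image]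
      exact ⟨A, Finset.mem_filter.mpr ⟨hAsupp, hPA⟩, rfl⟩
    have hdeg : (chartExponent q l A).degree = T + d := by
      rw [degree_fin3 hij hli.symm (Ne.symm hlj), chartExponent_apply, if_neg hli.symm, chartExponent_apply,
        if_neg (Ne.symm hlj), chartExponent_apply, if_pos rfl, hAdeg, hAi, hAj]
      omega
    exact (mem_support_iff.mp hmem) (hvanish _ hdeg)

end Walk

end Summit.ResolutionOfSingularities.ResolutionOfSingularities.Theorems.LossEpisode
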